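import Mathlib
/-!
# P7Part2Odd62 — the finite facts behind the (6,2) item of the odd-side prime-power sweep, kernel-checked at the prime 13
(proofs/P7-NonSimpleRowsFermatSweep-Part2Odd-v1.1.md = the (6,2) note of record, lead (g12) STATUS l.3840 (2); the corrected sentence of
record l.3808 (2); ROUTE v1.46+ §3)

The model (Theorem 3′ (ii)–(iii) of the PART 1 page; the note's «THE MODEL AND THE TEST»): `T = ℤ/12`, `ι = 6`; the sixfold block is `ℤ/12`
itself (`g₁ = 6`), the surface block is `ℤ/4 = ℤ/12 / ⟨4⟩` (`g₂ = 2`); a configuration = a primitive CM type `Φ_S ⊂ ℤ/12` (one of each pair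
`{x, x + 6}`, fixed by no translation) together with a CM type `Φ_C ⊂ ℤ/4` (one of each pair `{y, y + 2}`), up to simultaneous translation;
`F = ℚ(ζ₁₃)`, `G₁₃ = (ℤ/13)^× ≅ ℤ/12` through the primitive root `2` (`e ↦ 2^e mod 13`), `ψ_u : e ↦ u·e` for `u ∈ (ℤ/12)^× = {1, 5, 7, 11}`,
every `ψ_u` sending `ι = 6` to `2⁶ = −1 mod 13`; `FT(13)` = the Fermat types of degree 13, `Φ_{a,b} = {t ∈ G₁₃ : ⟨ta⟩ + ⟨tb⟩ < 13}` for the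
admissible pairs (`a, b, a + b ≢ 0 mod 13`); a configuration HITS at 13 iff for SOME `u` the image of `Φ_S` and the image of the lift of
`Φ_C` to `ℤ/12` (the preimage under `ℤ/12 → ℤ/4`) are both in `FT(13)` — then both factors are Fermat-reachable at 13 through the one `ψ_u`.

Certified by `decide`: (1) `e ↦ 2^e mod 13` is a bijection `ℤ/12 → G₁₃`, multiplicative on exponents, with `2⁶ = 12 = −1`; `{1, 5, 7, 11}` are
exactly the units of `ℤ/12`. (2) `FT(13)` consists of exactly 28 of the 64 CM types of `ℚ(ζ₁₃)` (= p6 §5.3's 28 / 64 = the note's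
part2odd_control62) and is closed under translation by `G₁₃`; the four `⟨3⟩`-stable CM types — the CM types of the cyclic quartic subfield
`ℚ(ζ₁₃)^{⟨3⟩}` — are ALL in `FT(13)`, so the surface block is Fermat-reachable for every surface type and every `u`. (3) The three deposited
sixfold classes of Tidx 23 (the note's Reading B and Theorem C: `[0,1,3,5,8,10]`, `[0,1,8,9,10,11]`, `[0,1,3,8,10,11]`) are primitive CM types
of `ℤ/12` in three distinct translation classes, with `u`-sets `{5, 7}`, `{1, 11}` and `∅`; hence of the 12 deposited configurations (three
classes × four surface types) EXACTLY 8 hit at 13 — the eight members of the item — and the four of the class `[0,1,3,8,10,11]` do not.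
(4) At the model level: the 60 primitive CM types of `ℤ/12` form 5 translation classes, of which 4 hit for some `u` (the two classes carrying
no deposited line give the note's 8 model-only hits) and 1 never does. NOT certified: the identification of the model's configurations with the
census's deposited lines (Reading B, a reading of the frozen deposit), Lemma A (Galois theory), anything at a conductor other than 13 (the hits
at 169, 2197, 28561 go through Theorem 5.8.1's chain and re-find the same members), and the closure itself (Sh81-1 Thm 4.4 p. 72 for `A′` +
the descent to isogeny factors — PUBLISHED / PROVED-HERE on the lane's pages, never here). Supporting, cited beside the note, never frozen;
Mathlib only.
-/

namespace HodgeRepro0.P7Part2Odd62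

/-- The units of `ℤ/13`: `1, …, 12`. -/
def G13 : List ℕ := [1, 2, 3, 4, 5, 6, 7, 8, 9, 10, 11, 12]

/-- The elements of `ℤ/12`. -/
def Z12 : List ℕ := List.range 12

/-- The units of `ℤ/12`, the `u` of the isomorphisms `ψ_u`. -/
def units12 : List ℕ := [1, 5, 7, 11]

/-- The exponent map `e ↦ 2^e mod 13` (`2` a primitive root mod 13). -/
def pow2 (e : ℕ) : ℕ := (2 ^ (e % 12)) % 13

/-- Sorted copy (set comparison of lists of naturals). -/
def srt (S : List ℕ) : List ℕ := S.insertionSort (· ≤ ·)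

/-- `S` and `S'` are the same set (as sorted lists; all lists here are duplicate-free). -/
def sameSet (S S' : List ℕ) : Bool := srt S == srt S'

/-- (1) `e ↦ 2^e mod 13` is a bijection `ℤ/12 → G₁₃`, multiplicative on exponents, `2⁶ = 12 = −1`;
`{1, 5, 7, 11}` are exactly the units of `ℤ/12`. -/
theorem pow2_facts : sameSet (Z12.map pow2) G13 = true ∧
    Z12.all (fun e => Z12.all (fun f => pow2 (e + f) == (pow2 e * pow2 f) % 13)) = true ∧ pow2 6 = 12 ∧
    Z12.filter (fun u => Z12.any (fun v => (u * v) % 12 == 1)) = units12 := by decide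

/-- The Fermat type `Φ_{a,b}` of degree 13: the units `t` with `⟨ta⟩ + ⟨tb⟩ < 13`. -/
def ftype (a b : ℕ) : List ℕ := G13.filter (fun t => (t * a) % 13 + (t * b) % 13 < 13)

/-- `(a, b)` admissible: `a, b, a + b ≢ 0 (mod 13)`. -/
def admissible (a b : ℕ) : Bool := 0 < a && a < 13 && 0 < b && b < 13 && (a + b) % 13 != 0

/-- `FT(13)`: the Fermat types of degree 13 as sorted lists, one copy each (all admissible pairs `(a, b)`). -/
def FT13 : List (List ℕ) :=
  ((List.range 13).flatMap (fun a => (List.range 13).filterMap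
    (fun b => if admissible a b then some (srt (ftype a b)) else none))).eraseDups

/-- `S` is a Fermat type of degree 13. -/
def isFermat (S : List ℕ) : Bool := FT13.contains (srt S)

/-- The 64 CM types of `ℚ(ζ₁₃)`: one of each pair `{t, 13 − t}`, `t = 1, …, 6`, chosen by the bits of `n < 64`. -/
def cmType13 (n : ℕ) : List ℕ := (List.range 6).map (fun i => if (n / 2 ^ i) % 2 == 0 then i + 1 else 12 - i)

/-- The CM types of `ℚ(ζ₁₃)` (64 lists). -/
def cmTypes13 : List (List ℕ) := (List.range 64).map cmType13

/-- `S` is stable under multiplication by `3` (the subgroup `⟨3⟩ = {1, 3, 9}` of `G₁₃`): a CM type of the quartic subfield. -/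
def stable3 (S : List ℕ) : Bool := sameSet S (S.map (fun t => (3 * t) % 13))

/-- (2) `FT(13)` = 28 sets, every one a CM type of `ℚ(ζ₁₃)` (so 28 of the 64); closed under translation by `G₁₃`;
the four `⟨3⟩`-stable CM types are all in `FT(13)`. -/
theorem FT13_facts : FT13.length = 28 ∧ FT13.all (fun S => cmTypes13.any (fun C => sameSet S C)) = true ∧
    (cmTypes13.filter isFermat).length = 28 ∧
    FT13.all (fun S => G13.all (fun t => isFermat (S.map (fun s => (s * t) % 13)))) = true ∧
    (cmTypes13.filter stable3).length = 4 ∧ (cmTypes13.filter stable3).all isFermat = true := by decide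

/-- The image of an exponent set `Φ ⊂ ℤ/12` under `ψ_u` followed by `e ↦ 2^e`: `{2^{u·e mod 12} mod 13}`. -/
def image (u : ℕ) (Phi : List ℕ) : List ℕ := Phi.map (fun e => pow2 ((u * e) % 12))

/-- The lift of a surface type `Φ_C ⊂ ℤ/4` to `ℤ/12`: the exponents `e` with `e mod 4 ∈ Φ_C`. -/
def lift (PhiC : List ℕ) : List ℕ := Z12.filter (fun e => PhiC.contains (e % 4))

/-- The `u ∈ (ℤ/12)^×` for which `ψ_u(Φ)` is a Fermat type of degree 13. -/
def uSet (Phi : List ℕ) : List ℕ := units12.filter (fun u => isFermat (image u Phi))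

/-- The configuration `(Φ_S, Φ_C)` hits at 13: for some `u` both blocks' images are Fermat types of degree 13. -/
def hits (PhiS PhiC : List ℕ) : Bool :=
  units12.any (fun u => isFermat (image u PhiS) && isFermat (image u (lift PhiC)))

/-- `Φ` is a CM type of `ℤ/12`: six exponents, one of each pair `{x, x + 6}`. -/
def isCM12 (Phi : List ℕ) : Bool :=
  Phi.length == 6 && (List.range 6).all (fun x => (Phi.contains x && !Phi.contains (x + 6)) || (!Phi.contains x && Phi.contains (x + 6)))

/-- The translate `Φ + t` in `ℤ/12`. -/
def translate (t : ℕ) (Phi : List ℕ) : List ℕ := Phi.map (fun x => (x + t) % 12)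

/-- `Φ` is primitive: fixed by no non-trivial translation of `ℤ/12`. -/
def isPrimitive12 (Phi : List ℕ) : Bool := (List.range 11).all (fun t => !sameSet Phi (translate (t + 1) Phi))

/-- A numerical key of a sorted list of exponents `< 16` (base 16), for choosing representatives. -/
def key (S : List ℕ) : ℕ := S.foldl (fun acc x => acc * 16 + x) 0

/-- The canonical representative of the translation class of `Φ`: the sorted translate of least key. -/
def canon (Phi : List ℕ) : List ℕ :=
  (Z12.map (fun t => srt (translate t Phi))).foldl (fun acc S => if key S < key acc then S else acc) (srt Phi)

/-- The three deposited sixfold classes of Tidx 23 (Reading B / Theorem C of the note). -/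
def sixfoldClasses : List (List ℕ) := [[0, 1, 3, 5, 8, 10], [0, 1, 8, 9, 10, 11], [0, 1, 3, 8, 10, 11]]

/-- The four surface types `Φ_C ⊂ ℤ/4` (one of each pair `{0, 2}`, `{1, 3}`). -/
def surfaceTypes : List (List ℕ) := [[0, 1], [0, 3], [2, 1], [2, 3]]

/-- The 12 deposited configurations: three sixfold classes × four surface types. -/
def configurations : List (List ℕ × List ℕ) :=
  sixfoldClasses.flatMap (fun S => surfaceTypes.map (fun C => (S, C)))

/-- (3a) The surface block is Fermat-reachable for every surface type and every `u`: the lifted types map onto the quartic's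
`⟨3⟩`-stable CM types, all in `FT(13)`. -/
theorem surface_always : surfaceTypes.all (fun C => units12.all (fun u => isFermat (image u (lift C)))) = true ∧
    surfaceTypes.all (fun C => units12.all (fun u => stable3 (image u (lift C)))) = true := by decide

/-- (3b) The three deposited sixfold classes are primitive CM types of `ℤ/12` in three distinct translation classes, with
`u`-sets `{5, 7}`, `{1, 11}`, `∅`. -/
theorem sixfold_usets : sixfoldClasses.all (fun S => isCM12 S && isPrimitive12 S) = true ∧
    (sixfoldClasses.map canon).Nodup ∧ sixfoldClasses.map uSet = [[5, 7], [1, 11], []] := by decide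

/-- (3c) Of the 12 deposited configurations exactly 8 hit at 13 — those with sixfold class `[0,1,3,5,8,10]` or `[0,1,8,9,10,11]`,
each with all four surface types — and the four of class `[0,1,3,8,10,11]` do not. -/
theorem eight_of_twelve : configurations.length = 12 ∧ (configurations.filter (fun c => hits c.1 c.2)).length = 8 ∧
    configurations.all (fun c => hits c.1 c.2 == (c.1 != [0, 1, 3, 8, 10, 11])) = true := by decide

/-- The 64 CM types of `ℤ/12` (one of each pair `{x, x + 6}`, chosen by the bits of `n < 64`). -/
def cmType12 (n : ℕ) : List ℕ := (List.range 6).map (fun i => if (n / 2 ^ i) % 2 == 0 then i else i + 6)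

/-- The primitive CM types of `ℤ/12`. -/
def primitiveTypes : List (List ℕ) := ((List.range 64).map cmType12).filter isPrimitive12

/-- The canonical representatives of the translation classes of the primitive CM types of `ℤ/12`. -/
def primitiveClasses : List (List ℕ) := (primitiveTypes.map canon).eraseDups

/-- (4) The model level: 60 primitive CM types of `ℤ/12` in 5 translation classes, each class of 12 types; exactly 4 classes hit for
some `u`; the three deposited classes' representatives are among the five; the two classes without a deposited line — the
representatives `[0,1,2,5,9,10]` and `[0,1,2,4,5,9]` — have `u`-sets `{7, 11}` and `{1, 5}` (the note's 8 model-only hits);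
the class of `[0,1,3,8,10,11]` is the only one that never hits. -/
theorem model_level : primitiveTypes.length = 60 ∧ primitiveClasses.length = 5 ∧
    primitiveClasses.all (fun S => (primitiveTypes.filter (fun P => canon P == S)).length == 12) = true ∧
    (primitiveClasses.filter (fun S => !(uSet S).isEmpty)).length = 4 ∧
    sixfoldClasses.all (fun S => primitiveClasses.contains (canon S)) = true ∧
    primitiveClasses.filter (fun S => !sixfoldClasses.any (fun D => canon D == S)) = [[0, 1, 2, 5, 9, 10], [0, 1, 2, 4, 5, 9]] ∧
    (primitiveClasses.filter (fun S => !sixfoldClasses.any (fun D => canon D == S))).map uSet = [[7, 11], [1, 5]] ∧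
    primitiveClasses.filter (fun S => (uSet S).isEmpty) = [canon [0, 1, 3, 8, 10, 11]] := by decide

end HodgeRepro0.P7Part2Odd62
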